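import Literature.AlgebraicGeometry.HodgeTheory.UniversalHypersurfaceDiscriminant
import Literature.AlgebraicGeometry.Motives.MonomialSupportedHypersurfaceFamily
import Literature.AlgebraicGeometry.Motives.GeneralNonsingularForms
import HarnessLib

/-!
# K1-B meridian package I — one-node centres (route `SignSymmetricPowers`, item stmt-HodgeConjecture-19716):
# along a pencil through a one-nodal form exactly one prime factor of the restricted discriminant vanishes,
# simply and transversally

Helper file (`--supports stmt-HodgeConjecture-19716`) for the open stubs GEN (`stub_signMeridianGeneration`) and
LINK (`stub_signConfluenceLinkG`) of the K1-B line `andre-zariski` (skeleton v12d/e); it is the ONE-NODE half of the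
"meridian package" of memos K1B-LINKF-PLAN-g23 §3a and K1B-GEN-STUBPLAN-g23 H2(d)/H3, done with the product rule only
(no maximum-modulus / resultant analysis).  Setting: `Disc ∈ ℂ[a_m : |m| = d]` an equation of the discriminant
(`singularCoeffs = V(Disc)`, F-DISC-0), `D_M := killHom Disc ∈ ℂ[a_m : m ∈ M]` its restriction to the linear space
`A_M` of `M`-supported forms, `D_M = w · ∏ⱼ hⱼ` any factorisation (e.g. unit × prime factors with multiplicity), and
a pencil `c ↦ f₁ + c g` of `M`-supported forms through a ONE-nodal `f₁` (node `p`) with `g(p) ≠ 0`.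

* §1 `eval_aeval_line`, `derivative_aeval_line_eval_zero`, `hasDerivAt_eval_line` — the restriction of
  `h ∈ ℂ[a]` to the line `c ↦ a + c v` is the univariate polynomial `aeval (a_k + v_k X) h`; its derivative at `0` is
  `Σ_k ∂_k h(a) v_k` (the `transversal` field of `FundamentalGroup.Meridian`).
* §2 **`exists_unique_factor_of_hasDerivAt_ne_zero`** — if `D = w ∏ hⱼ` vanishes at `a`, `w(a) ≠ 0`, and
  `c ↦ D(a + cv)` has non-zero derivative at `0`, then EXACTLY ONE `hⱼ` vanishes at `a` (so no repeated factor does: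
  multiplicity one) and `Σ_k ∂_k hⱼ(a) v_k ≠ 0` (`D = hⱼ · R`, `D'(0) = hⱼ'(0) R(a)`).
* §3 `hasDerivAt_eval_disc_pencil` — from the SHAPE delivered by F-DISC-1 (`discriminant_localBranches_nodal`) at a
  one-nodal form (`Disc = u · φ` near `a₁`, `dφ(a₁) = c₀ ev_p`): `c ↦ Disc(a₁ + c · coeffsOf g)` has derivative
  `u(a₁) c₀ g(p)` at `0`.
* §4 `eval_killHom` (`D_M(a) = Disc(ext a)`), `coeffsOf_mem_singularCoeffs` (a nodal form is singular), and the
  consumer **`exists_unique_factor_pencil`**: GRANTED F-DISC-1, at `a = coeff_M f₁` exactly one factor of `D_M`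
  vanishes, transversally to `v = coeff_M g` — the `Meridian` fields `eval_center`, `eval_center_ne`, `transversal`
  of the pencil circle `f₁ + ε e^{2πiθ} g`, for Π- and L-type centres (and the one-node members of the symmetric-`A₃`
  confluence).  The pair centres (two exchanged nodes: `D_M` vanishes to order two along the pencil) are NOT covered
  here — they need the component decomposition G2.

Sorry-free; axioms standard; no definition, no named fact (F-DISC-1 enters as a hypothesis of §4 only).

## References

* [VoisinHodgeII2003] C. Voisin, Hodge Theory and Complex Algebraic Geometry II (CUP 2003), §2.1.1 Lemma 2.7,
  Cor. 2.8, p. 70; §2.3.1.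
* [Shimada2010ZvK] I. Shimada, Lectures on Zariski–van Kampen theorem (arXiv:0906.1074), §3 (leashed discs, Prop. 3.4).
* [Hartshorne1977] R. Hartshorne, Algebraic Geometry, II Ex. 2.18(c), I Ex. 5.8.
-/

noncomputable section

set_option linter.dupNamespace false

open MvPolynomial
open Literature.AlgebraicGeometry.Motives Literature.AlgebraicGeometry.Motives.UniversalHypersurface
open Literature.AlgebraicGeometry.HodgeTheory

namespace Summit.HodgeConjecture.HodgeConjecture.Theorems.SignSymmetricPowersMeridianOneNode

/-! ### §1 Restricting a polynomial to a line: the derivative at the centre -/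

section Line

variable {σ : Type*} [Fintype σ] [DecidableEq σ]

omit [Fintype σ] [DecidableEq σ] in
/-- Evaluating the restriction `h(a + c v)` of `h` to the line `c ↦ a + c v`: the univariate polynomial
`aeval (a_k + v_k X) h` evaluates at `c` to `h(a + c • v)`. [folklore] -/
theorem eval_aeval_line (a v : σ → ℂ) (h : MvPolynomial σ ℂ) (c : ℂ) :
    Polynomial.eval c (aeval (fun k => Polynomial.C (a k) + Polynomial.C (v k) * Polynomial.X) h) =
      MvPolynomial.eval (a + c • v) h := by
  induction h using MvPolynomial.induction_on with
  | C r => rw [aeval_C, Polynomial.algebraMap_eq, Polynomial.eval_C, MvPolynomial.eval_C]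
  | add p q hp hq => rw [map_add, Polynomial.eval_add, hp, hq, map_add]
  | mul_X p k hp =>
    rw [map_mul, Polynomial.eval_mul, hp, aeval_X, map_mul, MvPolynomial.eval_X, Polynomial.eval_add,
      Polynomial.eval_C, Polynomial.eval_mul, Polynomial.eval_C, Polynomial.eval_X, Pi.add_apply,
      Pi.smul_apply, smul_eq_mul, mul_comm (v k) c]

/-- **The derivative of `h` along the line `c ↦ a + c v` at `c = 0` is `Σ_k ∂_k h(a) v_k`** (formal Taylor
expansion; the field `transversal` of `Meridian`). [folklore] -/
theorem derivative_aeval_line_eval_zero (a v : σ → ℂ) (h : MvPolynomial σ ℂ) :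
    Polynomial.eval 0 (Polynomial.derivative
      (aeval (fun k => Polynomial.C (a k) + Polynomial.C (v k) * Polynomial.X) h)) =
      ∑ k, MvPolynomial.eval a (pderiv k h) * v k := by
  induction h using MvPolynomial.induction_on with
  | C r =>
    rw [aeval_C, Polynomial.algebraMap_eq, Polynomial.derivative_C, Polynomial.eval_zero]
    simp only [pderiv_C, map_zero, zero_mul, Finset.sum_const_zero]
  | add p q hp hq =>
    rw [map_add, Polynomial.derivative_add, Polynomial.eval_add, hp, hq, ← Finset.sum_add_distrib]
    refine Finset.sum_congr rfl fun k _ => ?_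
    rw [map_add, map_add, add_mul]
  | mul_X p k hp =>
    have h0 : Polynomial.eval 0 (aeval (fun k => Polynomial.C (a k) + Polynomial.C (v k) * Polynomial.X) p) =
        MvPolynomial.eval a p := by
      rw [eval_aeval_line, zero_smul, add_zero]
    rw [map_mul, aeval_X, Polynomial.derivative_mul, Polynomial.eval_add, Polynomial.eval_mul,
      Polynomial.eval_mul, hp, h0]
    simp only [Polynomial.derivative_add, Polynomial.derivative_C, Polynomial.derivative_mul,
      Polynomial.derivative_X, zero_add, mul_one, zero_mul, Polynomial.eval_C, Polynomial.eval_add,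
      Polynomial.eval_mul, Polynomial.eval_X, mul_zero, add_zero]
    -- right-hand side: Leibniz for `pderiv`
    have hR : ∀ i, MvPolynomial.eval a (pderiv i (p * X k)) * v i =
        MvPolynomial.eval a (pderiv i p) * v i * a k + (if i = k then MvPolynomial.eval a p * v k else 0) := by
      intro i
      rw [Derivation.leibniz, smul_eq_mul, smul_eq_mul, pderiv_X, map_add, map_mul, map_mul,
        MvPolynomial.eval_X]
      split_ifs with hik
      · subst hik
        rw [Pi.single_eq_same, map_one]
        ring
      · rw [Pi.single_apply, if_neg (fun h => hik h.symm), map_zero]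
        ring
    simp_rw [hR]
    rw [Finset.sum_add_distrib, Finset.sum_ite_eq' Finset.univ k, if_pos (Finset.mem_univ _),
      ← Finset.sum_mul]

/-- The restriction of a polynomial to a line is differentiable with derivative `Σ_k ∂_k h(a) v_k` at the
centre. [folklore] -/
theorem hasDerivAt_eval_line (a v : σ → ℂ) (h : MvPolynomial σ ℂ) :
    HasDerivAt (fun c : ℂ => MvPolynomial.eval (a + c • v) h) (∑ k, MvPolynomial.eval a (pderiv k h) * v k) 0 := by
  have hP := Polynomial.hasDerivAt
    (aeval (fun k => Polynomial.C (a k) + Polynomial.C (v k) * Polynomial.X) h) (0 : ℂ)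
  rw [derivative_aeval_line_eval_zero] at hP
  refine hP.congr_of_eventuallyEq (Filter.Eventually.of_forall fun c => ?_)
  exact (eval_aeval_line a v h c).symm

end Line

/-! ### §2 A simple zero of a product along a line sits on exactly one factor, transversally -/

section Factor

variable {σ : Type*} [Fintype σ] [DecidableEq σ] {m : ℕ}

/-- **One-node centres of meridians.** Let `D = w · ∏ⱼ hⱼ` in `ℂ[a]` (any factorisation — e.g. a unit times
the prime factors WITH multiplicity), `a` a zero of `D` with `w(a) ≠ 0`, and `v` a direction along which
`c ↦ D(a + c v)` has NON-ZERO derivative at `0`.  Then exactly one factor `h_{j₀}` vanishes at `a` (so a repeated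
factor cannot vanish at `a`: multiplicity one) and the line is transversal to `V(h_{j₀})` at `a`:
`Σ_k ∂_k h_{j₀}(a) v_k ≠ 0` — the fields `eval_center`, `eval_center_ne`, `transversal` of
`FundamentalGroup.Meridian` for the straight disc `c ↦ a + c v`. (Product rule: `D = h_{j₀} · R` with
`D'(0) = h_{j₀}'(0) R(a)`.) [cite: Shimada2010ZvK, §3 Definition before Prop. 3.4] [cite: VoisinHodgeII2003, §2.1.1 Cor. 2.8] -/
theorem exists_unique_factor_of_hasDerivAt_ne_zero (w : MvPolynomial σ ℂ) (h : Fin m → MvPolynomial σ ℂ)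
    (a v : σ → ℂ) {D' : ℂ} (hD' : D' ≠ 0)
    (hderiv : HasDerivAt (fun c : ℂ => MvPolynomial.eval (a + c • v) (w * ∏ j, h j)) D' 0)
    (hw : MvPolynomial.eval a w ≠ 0) (hDa : MvPolynomial.eval a (w * ∏ j, h j) = 0) :
    ∃ j₀, MvPolynomial.eval a (h j₀) = 0 ∧ (∀ i, i ≠ j₀ → MvPolynomial.eval a (h i) ≠ 0) ∧
      ∑ k, MvPolynomial.eval a (pderiv k (h j₀)) * v k ≠ 0 := by
  -- some factor vanishes at `a`
  rw [map_mul, map_prod, mul_eq_zero, Finset.prod_eq_zero_iff] at hDa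
  obtain ⟨j₀, -, hj₀⟩ := hDa.resolve_left hw
  -- `D = h_{j₀} · R`
  set R : MvPolynomial σ ℂ := w * ∏ j ∈ Finset.univ.erase j₀, h j with hR
  have hDR : w * ∏ j, h j = h j₀ * R := by
    rw [hR, ← Finset.mul_prod_erase Finset.univ h (Finset.mem_univ j₀)]
    ring
  have hprod : HasDerivAt (fun c : ℂ => MvPolynomial.eval (a + c • v) (w * ∏ j, h j))
      ((∑ k, MvPolynomial.eval a (pderiv k (h j₀)) * v k) * MvPolynomial.eval (a + (0 : ℂ) • v) R +
        MvPolynomial.eval (a + (0 : ℂ) • v) (h j₀) * (∑ k, MvPolynomial.eval a (pderiv k R) * v k)) 0 := by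
    have h1 := (hasDerivAt_eval_line a v (h j₀)).mul (hasDerivAt_eval_line a v R)
    refine h1.congr_of_eventuallyEq (Filter.Eventually.of_forall fun c => ?_)
    simp only [hDR, map_mul, Pi.mul_apply]
  rw [zero_smul, add_zero, hj₀, zero_mul, add_zero] at hprod
  have hD'eq : D' = (∑ k, MvPolynomial.eval a (pderiv k (h j₀)) * v k) * MvPolynomial.eval a R :=
    hderiv.unique hprod
  rw [hD'eq] at hD'
  refine ⟨j₀, hj₀, fun i hi hia => ?_, left_ne_zero_of_mul hD'⟩
  apply right_ne_zero_of_mul hD'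
  rw [hR, map_mul, map_prod]
  exact mul_eq_zero_of_right _ (Finset.prod_eq_zero (Finset.mem_erase.2 ⟨hi, Finset.mem_univ i⟩) hia)

end Factor

/-! ### §3 The derivative of the discriminant along a pencil through a one-nodal form (from F-DISC-1's shape) -/

section Disc

variable (n d : ℕ)

/-- **Along the pencil `c ↦ f₁ + c g` through a ONE-nodal form `f₁` (node `p`, `g(p) ≠ 0`) the discriminant has
a simple zero**: if near `a₁ = coeffsOf f₁` the discriminant equation reads `Disc = u · φ` with `u(a₁) ≠ 0`,
`φ(a₁) = 0`, `dφ(a₁) = c₀ · ev_p` (the shape delivered by `discriminant_localBranches_nodal` for `k = 1`), then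
`c ↦ Disc(a₁ + c · coeffsOf g)` has derivative `u(a₁) · c₀ · g(p)` at `0`.
[cite: VoisinHodgeII2003, §2.1.1 Lemma 2.7, Cor. 2.8 and p. 70] -/
theorem hasDerivAt_eval_disc_pencil (Disc : MvPolynomial (DegIndex n d) ℂ) {W : Set (DegIndex n d → ℂ)}
    (hW : IsOpen W) {a₁ V : DegIndex n d → ℂ} (ha₁ : a₁ ∈ W) {φ u : (DegIndex n d → ℂ) → ℂ} {c₀ : ℂ}
    {p : Fin (n + 2) → ℂ} (hφ0 : φ a₁ = 0) (hφ : HasFDerivAt φ (c₀ • evalCoeffCLM n d p) a₁)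
    (hu : DifferentiableOn ℂ u W) (hDisc : ∀ a ∈ W, MvPolynomial.eval a Disc = u a * φ a) :
    HasDerivAt (fun c : ℂ => MvPolynomial.eval (a₁ + c • V) Disc) (u a₁ * (c₀ * evalCoeffCLM n d p V)) 0 := by
  -- the line `c ↦ a₁ + c V`
  have hline : HasDerivAt (fun c : ℂ => a₁ + c • V) V 0 := by
    simpa using ((hasDerivAt_id (0 : ℂ)).smul_const V).const_add a₁
  -- `u` and `φ` along the line
  have huA : DifferentiableAt ℂ u a₁ := hu.differentiableAt (hW.mem_nhds ha₁)
  have hu' : HasDerivAt (fun c : ℂ => u (a₁ + c • V)) (fderiv ℂ u a₁ V) 0 := by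
    have hl : HasFDerivAt u (fderiv ℂ u a₁) (a₁ + (0 : ℂ) • V) := by
      rw [zero_smul, add_zero]; exact huA.hasFDerivAt
    exact hl.comp_hasDerivAt (0 : ℂ) hline
  have hφ' : HasDerivAt (fun c : ℂ => φ (a₁ + c • V)) (c₀ * evalCoeffCLM n d p V) 0 := by
    have hl : HasFDerivAt φ (c₀ • evalCoeffCLM n d p) (a₁ + (0 : ℂ) • V) := by
      rw [zero_smul, add_zero]; exact hφ
    exact hl.comp_hasDerivAt (0 : ℂ) hline
  have hprod := hu'.mul hφ'
  simp only [zero_smul, add_zero, hφ0, mul_zero, zero_add] at hprod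
  -- `Disc = u φ` near `0` on the line
  refine hprod.congr_of_eventuallyEq ?_
  have hmem : ∀ᶠ c : ℂ in nhds 0, a₁ + c • V ∈ W := by
    have hc : Continuous fun c : ℂ => a₁ + c • V := by fun_prop
    have := hc.continuousAt.preimage_mem_nhds (x := (0 : ℂ)) (by simpa using hW.mem_nhds ha₁)
    exact this
  filter_upwards [hmem] with c hc
  exact hDisc _ hc

end Disc


/-! ### §4 On the linear space `A_M` of `M`-supported forms: `D_M = killHom Disc` -/

section Supported

variable (n d : ℕ) (M : Set (DegIndex n d)) [DecidablePred (· ∈ M)]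

/-- Evaluating `killHom G ∈ ℂ[a_m | m ∈ M]` at `a : M → ℂ` is evaluating `G` at the extension of `a` by zero.
[cite: Hartshorne1977, II Ex. 2.18(c)] -/
theorem eval_killHom (a : M → ℂ) (G : MvPolynomial (DegIndex n d) ℂ) :
    MvPolynomial.eval a (killHom ℂ n d M G) =
      MvPolynomial.eval (fun m : DegIndex n d => if h : m ∈ M then a ⟨m, h⟩ else 0) G := by
  induction G using MvPolynomial.induction_on with
  | C r =>
    rw [MvPolynomial.algHom_C, MvPolynomial.eval_C]
    exact (MvPolynomial.eval_C r)
  | add p q hp hq => rw [map_add, map_add, hp, hq, map_add]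
  | mul_X p m hp =>
    rw [map_mul, map_mul, hp, map_mul, MvPolynomial.eval_X]
    by_cases hm : m ∈ M
    · rw [killHom_X_of_mem ℂ n d M hm, MvPolynomial.eval_X, dif_pos hm]
    · rw [killHom_X_of_not_mem ℂ n d M hm, map_zero, dif_neg hm]

/-- The extension by zero of the `M`-coefficient vector of an `M`-supported form is its full coefficient
vector `coeffsOf`. [cite: VoisinHodgeII2003, §6.2.1] -/
theorem extend_coeffM_eq_coeffsOf {f : MvPolynomial (Fin (n + 2)) ℂ} (hM : IsSupportedOn n d M f) :
    (fun m : DegIndex n d => if h : m ∈ M then (fun m' : M => coeff m'.1.1 f) ⟨m, h⟩ else 0) = coeffsOf n d f := by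
  funext m
  by_cases hm : m ∈ M
  · rw [dif_pos hm, coeffsOf_apply]
  · rw [dif_neg hm, coeffsOf_apply, hM m hm]

/-- A form with an ordinary double point is a singular coefficient vector. [cite: VoisinHodgeII2003, §2.3.1] -/
theorem coeffsOf_mem_singularCoeffs {k : ℕ} {f : MvPolynomial (Fin (n + 2)) ℂ} (hf : f.IsHomogeneous d) (hd : 1 ≤ d)
    {p : Fin k → Fin (n + 2) → ℂ} (hp : IsNodalFormWithNodes f p) (i : Fin k) :
    coeffsOf n d f ∈ singularCoeffs n d := by
  rw [mem_singularCoeffs_iff, formOfCoeffs_coeffsOf n d hf]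
  intro hns
  obtain ⟨j, hj⟩ := hns.exists_eval_pderiv_ne_zero (hp.1 i).ne_zero ((hp.1 i).eval_eq_zero hf hd)
  exact hj ((hp.1 i).eval_pderiv j)

/-- **One-node centres on `A_M` (consumer shape for GEN / LINK-F).**  Let `Disc` be an equation of the
discriminant (`singularCoeffs = V(Disc)`, irreducible, as given by F-DISC-0), `D_M := killHom Disc` its restriction
to the `M`-supported forms, and `D_M = w · ∏ⱼ hⱼ` ANY factorisation in `ℂ[a_m | m ∈ M]` with `w` non-vanishing at
`a = coeff_M f₁` (e.g. the prime factorisation, primes repeated with multiplicity).  If `f₁` is `M`-supported with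
exactly ONE node `p`, and `g` is `M`-supported with `g(p) ≠ 0`, then — GRANTED F-DISC-1
(`discriminant_localBranches_nodal`) — exactly one factor `h_{j₀}` vanishes at `a`, and the pencil direction
`v = coeff_M g` is transversal to it: `Σ_k ∂_k h_{j₀}(a) v_k ≠ 0`.  (The `Meridian` fields `eval_center`,
`eval_center_ne`, `transversal` of the pencil circle `f₁ + ε e^{2πiθ} g`.)
[cite: VoisinHodgeII2003, §2.1.1 Lemma 2.7, Cor. 2.8, p. 70] [cite: Shimada2010ZvK, §3 Definition before Prop. 3.4] -/
theorem exists_unique_factor_pencil (hB : discriminant_localBranches_nodal) {Disc : MvPolynomial (DegIndex n d) ℂ}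
    (hirr : Irreducible Disc) (hV : ∀ a : DegIndex n d → ℂ, a ∈ singularCoeffs n d ↔ MvPolynomial.eval a Disc = 0)
    (hd : 1 ≤ d) {m : ℕ} (w : MvPolynomial M ℂ) (h : Fin m → MvPolynomial M ℂ)
    (hfac : killHom ℂ n d M Disc = w * ∏ j, h j)
    {f₁ g : MvPolynomial (Fin (n + 2)) ℂ} (hf₁ : f₁.IsHomogeneous d) (hg : g.IsHomogeneous d)
    (hM₁ : IsSupportedOn n d M f₁) (hMg : IsSupportedOn n d M g) {p : Fin (n + 2) → ℂ}
    (hnod : IsNodalFormWithNodes f₁ ![p]) (hgp : MvPolynomial.eval p g ≠ 0)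
    (hw : MvPolynomial.eval (fun m' : M => coeff m'.1.1 f₁) w ≠ 0) :
    haveI : Fintype M := Subtype.fintype _
    ∃ j₀, MvPolynomial.eval (fun m' : M => coeff m'.1.1 f₁) (h j₀) = 0 ∧
      (∀ i, i ≠ j₀ → MvPolynomial.eval (fun m' : M => coeff m'.1.1 f₁) (h i) ≠ 0) ∧
      ∑ k, MvPolynomial.eval (fun m' : M => coeff m'.1.1 f₁) (pderiv k (h j₀)) * (fun m' : M => coeff m'.1.1 g) k ≠ 0 := by
  classical
  obtain ⟨W, hW, ha₁, φ, u, c, hφ, hu, hu0, hDisc⟩ := hB n d 1 Disc hirr hV f₁ hf₁ ![p] hnod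
  obtain ⟨-, hφ0, hc0, hφd⟩ := hφ 0
  -- the derivative of `Disc` along the pencil, on the full coefficient space
  have hder := hasDerivAt_eval_disc_pencil n d Disc hW (V := coeffsOf n d g) ha₁ hφ0 hφd hu
    (fun a ha => by rw [hDisc a ha, Fin.prod_univ_one])
  have hD' : u (coeffsOf n d f₁) * (c 0 * evalCoeffCLM n d (![p] 0) (coeffsOf n d g)) ≠ 0 := by
    refine mul_ne_zero (hu0 _ ha₁) (mul_ne_zero hc0 ?_)
    rw [evalCoeffCLM_coeffsOf hg]
    exact hgp
  -- read it on `A_M` through `killHom`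
  have hline : ∀ cc : ℂ, MvPolynomial.eval ((fun m' : M => coeff m'.1.1 f₁) + cc • (fun m' : M => coeff m'.1.1 g))
      (w * ∏ j, h j) = MvPolynomial.eval (coeffsOf n d f₁ + cc • coeffsOf n d g) Disc := by
    intro cc
    have hpt : (fun m : DegIndex n d => if h : m ∈ M then
        ((fun m' : M => coeff m'.1.1 f₁) + cc • (fun m' : M => coeff m'.1.1 g)) ⟨m, h⟩ else 0) =
        coeffsOf n d f₁ + cc • coeffsOf n d g := by
      funext m
      by_cases hm : m ∈ M
      · simp only [dif_pos hm, Pi.add_apply, Pi.smul_apply, coeffsOf_apply]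
      · simp only [dif_neg hm, Pi.add_apply, Pi.smul_apply, coeffsOf_apply, hM₁ m hm, hMg m hm, smul_zero,
          add_zero]
    rw [← hfac, eval_killHom, hpt]
  have hderM : HasDerivAt (fun cc : ℂ => MvPolynomial.eval
      ((fun m' : M => coeff m'.1.1 f₁) + cc • (fun m' : M => coeff m'.1.1 g)) (w * ∏ j, h j))
      (u (coeffsOf n d f₁) * (c 0 * evalCoeffCLM n d (![p] 0) (coeffsOf n d g))) 0 :=
    hder.congr_of_eventuallyEq (Filter.Eventually.of_forall fun cc => hline cc)
  have hzero : MvPolynomial.eval (fun m' : M => coeff m'.1.1 f₁) (w * ∏ j, h j) = 0 := by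
    have h0 := hline 0
    rw [zero_smul, add_zero, zero_smul, add_zero] at h0
    rw [h0, ← hV]
    exact coeffsOf_mem_singularCoeffs n d hf₁ hd hnod 0
  exact exists_unique_factor_of_hasDerivAt_ne_zero w h _ _ hD' hderM hw hzero

end Supported

end Summit.HodgeConjecture.HodgeConjecture.Theorems.SignSymmetricPowersMeridianOneNode

end
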